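import Literature.MathematicalPhysics.QuantumLattice.Phi4VolumeMonotonicity
import Literature.Probability.LatticeModels.HighDimTriviality
import HarnessLib

/-!
# The doubling bound for the free-boundary `φ⁴` two-point function (`∑_{Λ_{rL}²} ⟨φφ⟩ ≤ C(r) ∑_{Λ_L²} ⟨φφ⟩`)

Proofs-only file (topic `Literature/MathematicalPhysics/QuantumLattice`; **theorems only, no
definition, no named fact**). On top of `Phi4VolumeMonotonicity.lean` (volume monotonicity,
thermodynamic limit `⨆_Λ ⟨φ_xφ_y⟩_Λ` along boxes, translation invariance) this file proves the one
consequence of "regularity" that the `φ⁴₄` triviality reduction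
`Literature.MathematicalPhysics.QuantumFieldTheory.phi44_triviality_of_wickDeviation`
(`QuantumFieldTheory/ContinuumLimitsPhi4WickProofs.lean`) takes as its hypothesis `hD` — the indicator
case of the printed upper variance bound `⟨T_{f,L}²⟩ ≤ C_f` of Aizenman–Duminil-Copin 2021 (p. 6,
display after Prop. 1.4: "`C r_f² ‖f‖_∞² ≥ ⟨T_{f,L}²⟩`"), for the free-boundary lattice `φ⁴` box
states on `ℤᵈ`, uniformly in the coupling `J ≥ 0` and the scale `L ≥ 1`:

**`phi4TwoPointBox_doubling`**: for `g > 0`, `κ`, `r ≥ 0` there is `C = 2 (2⌈r⌉₊+3)^{2d}` with, for all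
`J ≥ 0`, `L ≥ 1`, eventually as `R → ∞`,
`∑_{x,y ∈ Λ_{rL}} ⟨φ_xφ_y⟩_{box R} ≤ C ∑_{x,y ∈ Λ_L} ⟨φ_xφ_y⟩_{box R}`.

The argument is the covering / Cauchy–Schwarz argument of the tree's Ising version
(`normalizedField_variance_bounds_of_facts`, `HighDimTrivialityMoments` Part G: "translation-invariant
free state with non-negative two-point function; Griffiths monotonicity of second moments, a covering
argument and Cauchy–Schwarz"), run in finite volume: `Λ_{rL}` is covered by the `(2K+1)ᵈ` translates
`Λ_L + (2⌊L⌋₊+1)k`, `|kᵢ| ≤ K = ⌈r⌉₊ + 1` (`exists_translate_of_mem_latticeBox`,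
`sum_le_sum_sum_of_cover`); the kernel `⟨φ_xφ_y⟩_Λ` is positive semi-definite
(`sum_sum_mul_mul_phi4TwoPointIn_nonneg`: it is `⟨(∑ a_xφ_x)²⟩_Λ`), whence each cross block sum is at
most the mean of two diagonal ones (`sum_sum_phi4TwoPointIn_le_half`); a diagonal block sum is at most
`∑_{Λ_L²}` of the (translation-invariant) infinite-volume two-point function, which is the limit of the
reference sum `∑_{Λ_L²} ⟨φφ⟩_{box R}` and hence eventually at most twice it.

## Sources

* M. Aizenman, H. Duminil-Copin, Ann. Math. 194 (2021) = arXiv:1912.07973, p. 6 (display after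
  Prop. 1.4), §5 (p. 16: the infinite-volume state). [AizenmanDuminilCopinAnnals2021]
* J. Glimm, A. Jaffe, *Quantum Physics* (2nd ed. 1987), Prop. 4.2.1 (monotonicity; through
  `Phi4VolumeMonotonicity`). [GlimmJaffeQP1987]

## Tree / Mathlib anchors

`phi4TwoPointIn_le_iSup`, `iSup_phi4TwoPointIn_nonneg`, `hasBoxLimit_phi4TwoPointIn`,
`iSup_phi4TwoPointIn_shift`, `exists_box_supset` (`Phi4VolumeMonotonicity`); `phi4TwoPointIn_eq_of_mem`,
`phi4TwoPointIn_nonneg` (`LatticeScalarFieldGriffithsProofs`); `integrable_phi4Measure_of_abs_le`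
(`Phi4BoxGaussianBounds`); `latticeBox`, `mem_latticeBox` (`HighDimTriviality`); `box_mono`
(`ThermodynamicLimit`); `twoPoint_comm` (`Correlations`); Mathlib `Int.mul_ediv_add_emod`,
`Int.emod_nonneg`, `Int.emod_lt_of_pos`, `Filter.eventually_all_finset`, `tendsto_order`,
`Finset.sum_map`, `Equiv.addRight`.
-/

noncomputable section

open MeasureTheory Filter Topology Finset

namespace Literature.MathematicalPhysics.QuantumLattice

open Literature.Probability.LatticeModels

variable (d : ℕ)

/-! ### Part 1. Positive semi-definiteness of the two-point kernel -/

section PSD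

/-- **The free-boundary two-point function is a positive semi-definite kernel**:
`∑_{x,y ∈ Λ} a_x a_y ⟨φ_x φ_y⟩_Λ = ⟨(∑_x a_x φ_x)²⟩_Λ ≥ 0` for all real weights `a`. [folklore] -/
theorem sum_sum_mul_mul_phi4TwoPointIn_nonneg (Λ : Finset (Site d)) {g : ℝ} (hg : 0 < g) (κ J : ℝ)
    (a : Site d → ℝ) :
    0 ≤ ∑ x ∈ Λ, ∑ y ∈ Λ, a x * a y * phi4TwoPointIn d Λ g κ J x y := by
  classical
  set μ := phi4Measure (zdGraphIn d Λ) g κ J with hμ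
  have hint : ∀ x y : Λ, Integrable (fun ψ : Λ → ℝ => a x * a y * (ψ x * ψ y)) μ := fun x y =>
    (integrable_phi4Measure_of_abs_le (zdGraphIn d Λ) hg κ J (by fun_prop) (C := 1) (b := 1)
      (fun ψ => by
        rw [abs_mul, one_mul, one_mul]
        have hx := Finset.single_le_sum (fun z _ => sq_nonneg (ψ z)) (Finset.mem_univ x)
        have hy := Finset.single_le_sum (fun z _ => sq_nonneg (ψ z)) (Finset.mem_univ y)
        nlinarith [abs_nonneg (ψ x), abs_nonneg (ψ y), sq_abs (ψ x), sq_abs (ψ y),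
          Real.add_one_le_exp (∑ z, ψ z ^ 2), sq_nonneg (|ψ x| - |ψ y|)])).const_mul _
  have hsq : ∀ ψ : Λ → ℝ, (∑ x : Λ, a x * ψ x) ^ 2 = ∑ x : Λ, ∑ y : Λ, a x * a y * (ψ x * ψ y) :=
    fun ψ => by
    rw [sq, Finset.sum_mul_sum]
    exact Finset.sum_congr rfl fun x _ => Finset.sum_congr rfl fun y _ => by ring
  have key : ∑ x ∈ Λ, ∑ y ∈ Λ, a x * a y * phi4TwoPointIn d Λ g κ J x y =
      ∫ ψ, (∑ x : Λ, a x * ψ x) ^ 2 ∂μ := by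
    simp_rw [hsq]
    rw [integral_finsetSum _ fun x _ => integrable_finsetSum _ fun y _ => hint x y]
    rw [← Finset.sum_coe_sort Λ]
    refine Finset.sum_congr rfl fun x _ => ?_
    rw [integral_finsetSum _ fun y _ => hint x y, ← Finset.sum_coe_sort Λ]
    refine Finset.sum_congr rfl fun y _ => ?_
    rw [integral_const_mul, phi4TwoPointIn_eq_of_mem d Λ g κ J x.2 y.2]
  rw [key]
  exact integral_nonneg fun ψ => sq_nonneg _

/-- **Cauchy–Schwarz/AM–GM for the two-point kernel**: for `A, B ⊆ Λ`,
`∑_{x ∈ A, y ∈ B} ⟨φ_x φ_y⟩_Λ ≤ (∑_{A×A} ⟨φφ⟩_Λ + ∑_{B×B} ⟨φφ⟩_Λ)/2`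
(positive semi-definiteness tested on `𝟙_A - 𝟙_B`). [folklore] -/
theorem sum_sum_phi4TwoPointIn_le_half (Λ : Finset (Site d)) {g : ℝ} (hg : 0 < g) (κ J : ℝ)
    {A B : Finset (Site d)} (hA : A ⊆ Λ) (hB : B ⊆ Λ) :
    ∑ x ∈ A, ∑ y ∈ B, phi4TwoPointIn d Λ g κ J x y ≤
      ((∑ x ∈ A, ∑ y ∈ A, phi4TwoPointIn d Λ g κ J x y) +
        ∑ x ∈ B, ∑ y ∈ B, phi4TwoPointIn d Λ g κ J x y) / 2 := by
  classical
  set S : Site d → Site d → ℝ := phi4TwoPointIn d Λ g κ J with hS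
  have hsymm : ∀ x y, S x y = S y x := fun x y =>
    Literature.Probability.LatticeModels.twoPoint_comm _ _ x y
  set a : Site d → ℝ := fun x => (if x ∈ A then (1 : ℝ) else 0) - (if x ∈ B then (1 : ℝ) else 0)
    with ha
  have hpos := sum_sum_mul_mul_phi4TwoPointIn_nonneg d Λ hg κ J a
  have hind : ∀ (C : Finset (Site d)) (hC : C ⊆ Λ) (f : Site d → ℝ),
      ∑ x ∈ Λ, (if x ∈ C then (1 : ℝ) else 0) * f x = ∑ x ∈ C, f x := fun C hC f => by
    rw [← Finset.sum_subset hC (f := fun x => (if x ∈ C then (1 : ℝ) else 0) * f x)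
      (fun x _ hxC => by simp [hxC])]
    exact Finset.sum_congr rfl fun x hx => by simp [hx]
  have hexp : ∑ x ∈ Λ, ∑ y ∈ Λ, a x * a y * S x y =
      (∑ x ∈ A, ∑ y ∈ A, S x y) - (∑ x ∈ A, ∑ y ∈ B, S x y) - (∑ x ∈ B, ∑ y ∈ A, S x y) +
        ∑ x ∈ B, ∑ y ∈ B, S x y := by
    have h1 : ∀ x, ∑ y ∈ Λ, a x * a y * S x y =
        a x * ((∑ y ∈ A, S x y) - ∑ y ∈ B, S x y) := fun x => by
      rw [← hind A hA, ← hind B hB, ← Finset.sum_sub_distrib, Finset.mul_sum]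
      exact Finset.sum_congr rfl fun y _ => by rw [ha]; ring
    simp_rw [h1]
    have h2 : ∀ f : Site d → ℝ, ∑ x ∈ Λ, a x * f x = (∑ x ∈ A, f x) - ∑ x ∈ B, f x := fun f => by
      rw [← hind A hA, ← hind B hB, ← Finset.sum_sub_distrib]
      exact Finset.sum_congr rfl fun x _ => by rw [ha]; ring
    rw [h2]
    simp only [Finset.sum_sub_distrib]
    ring
  have hBA : ∑ x ∈ B, ∑ y ∈ A, S x y = ∑ x ∈ A, ∑ y ∈ B, S x y := by
    rw [Finset.sum_comm]
    exact Finset.sum_congr rfl fun x _ => Finset.sum_congr rfl fun y _ => hsymm _ _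
  rw [hexp, hBA] at hpos
  linarith

end PSD

/-! ### Part 2. Covering `Λ_{rL}` by boundedly many translates of `Λ_L` -/

section Covering

/-- **Sums over a covered set**: if every point of `X` lies in some `A k`, `k ∈ K`, then for `f ≥ 0`,
`∑_{x ∈ X} f x ≤ ∑_{k ∈ K} ∑_{x ∈ A k} f x`. [folklore] -/
theorem sum_le_sum_sum_of_cover {α ι : Type*} [DecidableEq α] (X : Finset α) (K : Finset ι)
    (A : ι → Finset α) (hcov : ∀ x ∈ X, ∃ k ∈ K, x ∈ A k) {f : α → ℝ} (hf : ∀ x, 0 ≤ f x) :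
    ∑ x ∈ X, f x ≤ ∑ k ∈ K, ∑ x ∈ A k, f x := by
  calc ∑ x ∈ X, f x ≤ ∑ x ∈ X, (∑ k ∈ K, if x ∈ A k then (1 : ℝ) else 0) * f x := by
        refine Finset.sum_le_sum fun x hx => le_mul_of_one_le_left (hf x) ?_
        obtain ⟨k, hk, hxk⟩ := hcov x hx
        calc (1 : ℝ) = if x ∈ A k then (1 : ℝ) else 0 := by rw [if_pos hxk]
          _ ≤ ∑ k ∈ K, if x ∈ A k then (1 : ℝ) else 0 :=
              Finset.single_le_sum (f := fun k => if x ∈ A k then (1 : ℝ) else 0)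
                (fun k _ => by positivity) hk
    _ = ∑ k ∈ K, ∑ x ∈ X, (if x ∈ A k then (1 : ℝ) else 0) * f x := by
        rw [Finset.sum_comm]
        exact Finset.sum_congr rfl fun x _ => Finset.sum_mul _ _ _
    _ ≤ ∑ k ∈ K, ∑ x ∈ A k, f x := Finset.sum_le_sum fun k _ => by
        calc ∑ x ∈ X, (if x ∈ A k then (1 : ℝ) else 0) * f x
            = ∑ x ∈ X.filter (· ∈ A k), f x := by
              rw [Finset.sum_filter]
              exact Finset.sum_congr rfl fun x _ => by split_ifs <;> simp
          _ ≤ ∑ x ∈ A k, f x :=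
              Finset.sum_le_sum_of_subset_of_nonneg (fun x hx => (Finset.mem_filter.1 hx).2)
                fun x _ _ => hf x

/-- **Covering of `Λ_{rL}` by translates of `Λ_L`**: for `L ≥ 1`, `r ≥ 0`, `n = ⌊L⌋₊`, `M = 2n+1`,
`K = ⌈r⌉₊ + 1`, every `x ∈ Λ_{rL}` satisfies `x - M k ∈ Λ_L` for some `k ∈ {-K,…,K}ᵈ`
(division with remainder in each coordinate). [folklore] -/
theorem exists_translate_of_mem_latticeBox {L r : ℝ} (hL : 1 ≤ L) (hr : 0 ≤ r) {x : Site d}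
    (hx : x ∈ latticeBox d (r * L)) :
    ∃ k ∈ Fintype.piFinset (fun _ : Fin d => Finset.Icc (-((⌈r⌉₊ : ℤ) + 1)) ((⌈r⌉₊ : ℤ) + 1)),
      (fun i => x i - (2 * (⌊L⌋₊ : ℤ) + 1) * k i) ∈ latticeBox d L := by
  set n : ℤ := (⌊L⌋₊ : ℤ) with hn
  set M : ℤ := 2 * n + 1 with hM
  have hn0 : 0 ≤ n := by positivity
  have hM0 : 0 < M := by rw [hM]; linarith
  have hnL : (n : ℝ) ≤ L := by
    rw [hn, Int.cast_natCast]
    exact Nat.floor_le (by linarith)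
  have hLM : L ≤ (M : ℝ) := by
    have h := Nat.lt_floor_add_one L
    rw [hM, hn]
    push_cast
    linarith
  have hMpos : (0 : ℝ) < M := by exact_mod_cast hM0
  set k : Site d := fun i => (x i + n) / M with hk
  set ρ : Fin d → ℤ := fun i => (x i + n) % M with hρ
  have hdiv : ∀ i, M * k i + ρ i = x i + n := fun i => Int.mul_ediv_add_emod (x i + n) M
  have hρ0 : ∀ i, 0 ≤ ρ i := fun i => Int.emod_nonneg _ hM0.ne'
  have hρM : ∀ i, ρ i < M := fun i => Int.emod_lt_of_pos _ hM0
  have hρ2n : ∀ i, ρ i ≤ 2 * n := fun i => by have := hρM i; rw [hM] at this; omega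
  have hxi : ∀ i, |((x i : ℤ) : ℝ)| ≤ r * L := fun i => mem_latticeBox.1 hx i
  -- real forms
  have hdivR : ∀ i, ((M * k i : ℤ) : ℝ) = (x i : ℝ) + n - ρ i := fun i => by
    have h := hdiv i
    have h' : M * k i = x i + n - ρ i := by linarith
    exact_mod_cast h'
  have hρ0R : ∀ i, (0 : ℝ) ≤ ρ i := fun i => by exact_mod_cast hρ0 i
  have hρ2nR : ∀ i, (ρ i : ℝ) ≤ 2 * n := fun i => by exact_mod_cast hρ2n i
  refine ⟨k, ?_, ?_⟩
  · rw [Fintype.mem_piFinset]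
    intro i
    rw [Finset.mem_Icc, ← abs_le]
    -- `|M k_i| ≤ |x_i| + n ≤ (r + 1) L ≤ (r + 1) M`, so `|k_i| ≤ r + 1 ≤ ⌈r⌉₊ + 1`
    have hx' := hxi i
    rw [abs_le] at hx'
    have h1 : |((k i : ℤ) : ℝ)| ≤ r + 1 := by
      rw [abs_le]
      have e : ((M * k i : ℤ) : ℝ) = (M : ℝ) * (k i : ℝ) := by push_cast; ring
      have hMk := hdivR i
      rw [e] at hMk
      constructor
      · by_contra hcon
        push Not at hcon
        have : (M : ℝ) * (k i : ℝ) < (M : ℝ) * (-(r + 1)) := by nlinarith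
        nlinarith [hρ2nR i, hx'.1]
      · by_contra hcon
        push Not at hcon
        have : (M : ℝ) * (r + 1) < (M : ℝ) * (k i : ℝ) := by nlinarith
        nlinarith [hρ0R i, hx'.2]
    have h2 : |((k i : ℤ) : ℝ)| ≤ (⌈r⌉₊ : ℝ) + 1 := h1.trans (by linarith [Nat.le_ceil r])
    have h3 : (((|k i| : ℤ)) : ℝ) ≤ (((⌈r⌉₊ : ℤ) + 1 : ℤ) : ℝ) := by
      rw [Int.cast_abs]
      push_cast
      exact h2
    exact_mod_cast h3
  · rw [mem_latticeBox]
    intro i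
    have e : x i - (2 * (⌊L⌋₊ : ℤ) + 1) * k i = ρ i - n := by
      have := hdiv i
      rw [hM] at this
      linarith
    rw [e]
    have h1 : |((ρ i - n : ℤ) : ℝ)| ≤ n := by
      rw [abs_le]
      push_cast
      constructor <;> linarith [hρ0R i, hρ2nR i]
    exact h1.trans hnL

end Covering

/-! ### Part 3. The doubling bound for the box two-point functions -/

section Doubling

/-- **Doubling bound for the free-boundary box two-point functions, eventually in the volume.**
For `g > 0`, `κ`, `r ≥ 0` there is `C = C(r, d)` such that for all `J ≥ 0` and `L ≥ 1`, eventually as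
`R → ∞`, `∑_{x,y ∈ Λ_{rL}} ⟨φ_xφ_y⟩_{box R} ≤ C ∑_{x,y ∈ Λ_L} ⟨φ_xφ_y⟩_{box R}`. Proof: cover `Λ_{rL}` by
the `(2K+1)ᵈ` translates `Λ_L + Mk` (`exists_translate_of_mem_latticeBox`); by positive
semi-definiteness each cross term is at most the mean of two diagonal block sums
(`sum_sum_phi4TwoPointIn_le_half`); a diagonal block sum is at most `∑_{Λ_L²}` of the infinite-volume
two-point function (`phi4TwoPointIn_le_iSup`, translation invariance `iSup_phi4TwoPointIn_shift`),
which is the limit of `∑_{Λ_L²} ⟨φφ⟩_{box R}` (`hasBoxLimit_phi4TwoPointIn`), hence eventually at most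
twice it. This is the indicator case of the upper variance bound `⟨T_{f,L}²⟩ ≤ C_f` of
Aizenman–Duminil-Copin 2021 (p. 6) for the free-boundary lattice `φ⁴` states, in the finite-volume
form consumed by `Literature.MathematicalPhysics.QuantumFieldTheory.phi44_triviality_of_wickDeviation`
(hypothesis `hD`). [cite: AizenmanDuminilCopinAnnals2021, arXiv:1912.07973 p. 6 (display after Prop. 1.4)] -/
theorem phi4TwoPointBox_doubling {g : ℝ} (hg : 0 < g) (κ : ℝ) {r : ℝ} (hr : 0 ≤ r) :
    ∃ C : ℝ, 0 ≤ C ∧ ∀ J : ℝ, 0 ≤ J → ∀ L : ℝ, 1 ≤ L → ∀ᶠ R : ℕ in atTop,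
      ∑ x ∈ latticeBox d (r * L), ∑ y ∈ latticeBox d (r * L), phi4TwoPointBox d R g κ J x y ≤
        C * ∑ x ∈ latticeBox d L, ∑ y ∈ latticeBox d L, phi4TwoPointBox d R g κ J x y := by
  classical
  set Kset : Finset (Site d) :=
    Fintype.piFinset (fun _ : Fin d => Finset.Icc (-((⌈r⌉₊ : ℤ) + 1)) ((⌈r⌉₊ : ℤ) + 1)) with hKset
  refine ⟨2 * (Kset.card : ℝ) ^ 2, by positivity, fun J hJ L hL => ?_⟩
  set M : ℤ := 2 * (⌊L⌋₊ : ℤ) + 1 with hM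
  set t : Site d → Site d := fun k i => M * k i with ht
  set A : Site d → Finset (Site d) := fun k =>
    (latticeBox d L).map (Equiv.addRight (t k)).toEmbedding with hA
  -- the infinite-volume two-point function and the limit of the reference block sum
  set Ainf : ℝ := ∑ x ∈ latticeBox d L, ∑ y ∈ latticeBox d L,
    ⨆ Λ : Finset (Site d), phi4TwoPointIn d Λ g κ J x y with hAinf
  have hS0 : ∀ (R : ℕ) (x y : Site d), 0 ≤ phi4TwoPointBox d R g κ J x y := fun R x y =>
    phi4TwoPointIn_nonneg d (box d R) hg κ hJ x y
  have hSle : ∀ (R : ℕ) (x y : Site d),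
      phi4TwoPointBox d R g κ J x y ≤ ⨆ Λ : Finset (Site d), phi4TwoPointIn d Λ g κ J x y :=
    fun R x y => phi4TwoPointIn_le_iSup d (box d R) hg κ hJ x y
  have hAinf0 : 0 ≤ Ainf := Finset.sum_nonneg fun x _ => Finset.sum_nonneg fun y _ =>
    iSup_phi4TwoPointIn_nonneg d hg κ hJ x y
  have hconv : Tendsto (fun R : ℕ =>
      ∑ x ∈ latticeBox d L, ∑ y ∈ latticeBox d L, phi4TwoPointBox d R g κ J x y) atTop (𝓝 Ainf) :=
    tendsto_finsetSum _ fun x _ => tendsto_finsetSum _ fun y _ =>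
      hasBoxLimit_phi4TwoPointIn d hg κ hJ x y
  -- the covering
  have hcov : ∀ x ∈ latticeBox d (r * L), ∃ k ∈ Kset, x ∈ A k := by
    intro x hx
    obtain ⟨k, hk, hxk⟩ := exists_translate_of_mem_latticeBox d hL hr hx
    refine ⟨k, hk, ?_⟩
    rw [hA, Finset.mem_map]
    refine ⟨fun i => x i - (2 * (⌊L⌋₊ : ℤ) + 1) * k i, hxk, ?_⟩
    funext i
    simp only [Equiv.coe_toEmbedding, Equiv.coe_addRight, Pi.add_apply, ht, hM]
    ring
  -- the translates lie in `box d R` eventually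
  have hbox : ∀ᶠ R : ℕ in atTop, ∀ k ∈ Kset, A k ⊆ box d R := by
    rw [Filter.eventually_all_finset]
    intro k _
    obtain ⟨R₀, hR₀⟩ := exists_box_supset d (A k)
    exact (eventually_ge_atTop R₀).mono fun R hR => hR₀.trans (box_mono d hR)
  -- each diagonal block sum is at most `Ainf`
  have hQ : ∀ (R : ℕ) (k : Site d), ∑ x ∈ A k, ∑ y ∈ A k, phi4TwoPointBox d R g κ J x y ≤ Ainf := by
    intro R k
    simp only [hA, Finset.sum_map, Equiv.coe_toEmbedding, Equiv.coe_addRight]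
    rw [hAinf]
    refine Finset.sum_le_sum fun a _ => Finset.sum_le_sum fun b _ => ?_
    rw [← iSup_phi4TwoPointIn_shift d (t k) g κ J a b]
    exact hSle R _ _
  -- eventually the reference block sum is at least `Ainf / 2`
  have hhalf : ∀ᶠ R : ℕ in atTop,
      Ainf ≤ 2 * ∑ x ∈ latticeBox d L, ∑ y ∈ latticeBox d L, phi4TwoPointBox d R g κ J x y := by
    rcases hAinf0.eq_or_lt with h0 | hpos
    · exact Eventually.of_forall fun R => by
        rw [← h0]
        exact mul_nonneg zero_le_two (Finset.sum_nonneg fun x _ => Finset.sum_nonneg fun y _ => hS0 R x y)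
    · have h := (tendsto_order.1 hconv).1 (Ainf / 2) (by linarith)
      exact h.mono fun R hR => by linarith
  filter_upwards [hbox, hhalf] with R hboxR hhalfR
  have hcard : ∑ _k ∈ Kset, ∑ _k' ∈ Kset, Ainf = (Kset.card : ℝ) ^ 2 * Ainf := by
    rw [Finset.sum_const, Finset.sum_const, nsmul_eq_mul, nsmul_eq_mul]
    ring
  calc ∑ x ∈ latticeBox d (r * L), ∑ y ∈ latticeBox d (r * L), phi4TwoPointBox d R g κ J x y
      ≤ ∑ x ∈ latticeBox d (r * L), ∑ k' ∈ Kset, ∑ y ∈ A k', phi4TwoPointBox d R g κ J x y :=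
        Finset.sum_le_sum fun x _ => sum_le_sum_sum_of_cover _ Kset A hcov (hS0 R x)
    _ ≤ ∑ k ∈ Kset, ∑ x ∈ A k, ∑ k' ∈ Kset, ∑ y ∈ A k', phi4TwoPointBox d R g κ J x y :=
        sum_le_sum_sum_of_cover _ Kset A hcov fun x =>
          Finset.sum_nonneg fun k' _ => Finset.sum_nonneg fun y _ => hS0 R x y
    _ = ∑ k ∈ Kset, ∑ k' ∈ Kset, ∑ x ∈ A k, ∑ y ∈ A k', phi4TwoPointBox d R g κ J x y :=
        Finset.sum_congr rfl fun k _ => Finset.sum_comm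
    _ ≤ ∑ k ∈ Kset, ∑ k' ∈ Kset,
          ((∑ x ∈ A k, ∑ y ∈ A k, phi4TwoPointBox d R g κ J x y) +
            ∑ x ∈ A k', ∑ y ∈ A k', phi4TwoPointBox d R g κ J x y) / 2 :=
        Finset.sum_le_sum fun k hk => Finset.sum_le_sum fun k' hk' =>
          sum_sum_phi4TwoPointIn_le_half d (box d R) hg κ J (hboxR k hk) (hboxR k' hk')
    _ ≤ ∑ _k ∈ Kset, ∑ _k' ∈ Kset, Ainf :=
        Finset.sum_le_sum fun k _ => Finset.sum_le_sum fun k' _ => by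
          linarith [hQ R k, hQ R k']
    _ = (Kset.card : ℝ) ^ 2 * Ainf := hcard
    _ ≤ (Kset.card : ℝ) ^ 2 *
          (2 * ∑ x ∈ latticeBox d L, ∑ y ∈ latticeBox d L, phi4TwoPointBox d R g κ J x y) :=
        mul_le_mul_of_nonneg_left hhalfR (by positivity)
    _ = 2 * (Kset.card : ℝ) ^ 2 *
          ∑ x ∈ latticeBox d L, ∑ y ∈ latticeBox d L, phi4TwoPointBox d R g κ J x y := by ring

end Doubling

end Literature.MathematicalPhysics.QuantumLattice

end
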